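import Mathlib
import HarnessLib
import Literature.Geometry.Lorentzian.KerrTimeDerivative
import Summits.FinalStateConjecture.FinalStateConjecture.Theorems.ZeroEnergyKerrOrBombKerrModeStabilityODE

/-!
# Route ZeroEnergyKerrOrBomb · item `KerrModeStability` — slice-energy bookkeeping

Helper file for item stmt-FinalStateConjecture-10024 (`KerrModeStability`): elementary
`lintegral` manipulations of the coordinate slice energies `sliceEnergy U ψ τ =
∫ 𝟙_{(τ,y) ∈ U} ∑_μ (∂_μψ̃)²(τ, y) dy` of `WeightedNorms.lean` used in the energy-growth
contradiction of the item:

* `kerr_measurable_coordEnergyDensity_slice` — the integrand is Borel measurable (for every `ψ`,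
  `measurable_fderiv_apply_const`);
* `kerr_setLIntegral_le_sliceEnergy_add` — a lower bound for the sum of two slice energies by an
  integral over a ball on which the summed density is known;
* `kerr_sliceEnergy_le_setLIntegral_closedBall`, `kerr_setLIntegral_indicator_two_mul_add_le` —
  upper bounds for a slice energy whose density vanishes outside a ball and is dominated inside;
* `kerrModePair_local_energy_pos` — for a Killing-mode pair `(ψ, χ)` (`ν > 0`) not vanishing at an
  exterior slice point, the summed density `e_ψ + e_χ` is bounded below by a positive constant on a
  small ball of exterior slice points around it.

No new definitions.
-/

noncomputable section

namespace Summit.FinalStateConjecture.FinalStateConjecture.Theorems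

open Literature.Geometry.Lorentzian Set Filter MeasureTheory
open scoped Manifold ContDiff Topology ENNReal

-- every `Summit.FinalStateConjecture.FinalStateConjecture.…` name repeats the summit = sub-problem segment (D-0017 layout)
set_option linter.dupNamespace false

/-- The slice-energy integrand `y ↦ ∑_μ (∂_μ ψ̃)²(τ, y)` is Borel measurable, for every `ψ`
(the derivative of an arbitrary function is measurable, `measurable_fderiv_apply_const`). -/
theorem kerr_measurable_coordEnergyDensity_slice (U : TopologicalSpace.Opens E4) (ψ : U → ℝ)
    (τ : ℝ) : Measurable fun y : E3 ↦ coordEnergyDensity U ψ (E4.ofTimeSpace τ y) := by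
  unfold coordEnergyDensity
  refine Finset.measurable_sum _ fun μ _ ↦ Measurable.pow_const ?_ _
  exact (measurable_fderiv_apply_const ℝ (Function.extend Subtype.val ψ (0 : E4 → ℝ))
    (EuclideanSpace.single μ (1 : ℝ))).comp (E4.continuous_ofTimeSpace τ).measurable

/-- The `ℝ≥0∞`-valued slice-energy integrand (with the cut-off to the chart) is measurable. -/
theorem kerr_measurable_sliceIntegrand (U : TopologicalSpace.Opens E4) (ψ : U → ℝ) (τ : ℝ) :
    Measurable fun y : E3 ↦ {y : E3 | E4.ofTimeSpace τ y ∈ U}.indicator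
      (fun y ↦ ENNReal.ofReal (coordEnergyDensity U ψ (E4.ofTimeSpace τ y))) y := by
  refine Measurable.indicator ?_ ((U.isOpen.preimage (E4.continuous_ofTimeSpace τ)).measurableSet)
  exact ENNReal.measurable_ofReal.comp (kerr_measurable_coordEnergyDensity_slice U ψ τ)

/-- **Lower bound for a sum of two slice energies.** If on a measurable set `B` of slice points
of the chart the two energy densities add up to `c · h`, then
`c ∫_B h ≤ sliceEnergy U ψ₁ τ + sliceEnergy U ψ₂ τ`. -/
theorem kerr_setLIntegral_le_sliceEnergy_add (U : TopologicalSpace.Opens E4) (ψ₁ ψ₂ : U → ℝ)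
    (τ : ℝ) {B : Set E3} (hB : MeasurableSet B) (hBU : ∀ y ∈ B, E4.ofTimeSpace τ y ∈ U)
    {c : ℝ≥0∞} (hc : c ≠ ⊤) (h : E3 → ℝ≥0∞)
    (hsum : ∀ y ∈ B, ENNReal.ofReal (coordEnergyDensity U ψ₁ (E4.ofTimeSpace τ y)) +
      ENNReal.ofReal (coordEnergyDensity U ψ₂ (E4.ofTimeSpace τ y)) = c * h y) :
    c * ∫⁻ y in B, h y ≤ sliceEnergy U ψ₁ τ + sliceEnergy U ψ₂ τ := by
  set S : Set E3 := {y : E3 | E4.ofTimeSpace τ y ∈ U} with hS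
  set F₁ : E3 → ℝ≥0∞ := fun y ↦ S.indicator
    (fun y ↦ ENNReal.ofReal (coordEnergyDensity U ψ₁ (E4.ofTimeSpace τ y))) y with hF₁
  set F₂ : E3 → ℝ≥0∞ := fun y ↦ S.indicator
    (fun y ↦ ENNReal.ofReal (coordEnergyDensity U ψ₂ (E4.ofTimeSpace τ y))) y with hF₂
  have hm₁ : Measurable F₁ := kerr_measurable_sliceIntegrand U ψ₁ τ
  have h12 : sliceEnergy U ψ₁ τ + sliceEnergy U ψ₂ τ = ∫⁻ y, (F₁ y + F₂ y) := by
    rw [lintegral_add_left hm₁]; rfl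
  rw [h12]
  calc c * ∫⁻ y in B, h y = ∫⁻ y in B, c * h y := (lintegral_const_mul' c _ hc).symm
    _ = ∫⁻ y in B, (F₁ y + F₂ y) := by
        refine setLIntegral_congr_fun hB fun y hy ↦ ?_
        rw [← hsum y hy]
        simp only [hF₁, hF₂, Set.indicator_of_mem (show y ∈ S from hBU y hy)]
    _ ≤ ∫⁻ y, (F₁ y + F₂ y) := setLIntegral_le_lintegral _ _

/-- **A slice energy whose density vanishes outside a ball is an integral over that ball**, and is
dominated there by any pointwise bound: if `e[ψ](τ, y) = 0` at all slice points of the chart with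
`‖y‖ > R` and `e[ψ](τ, y) ≤ g(y)` at those with `‖y‖ ≤ R`, then
`sliceEnergy U ψ τ ≤ ∫_{‖y‖ ≤ R} 𝟙_{(τ,y) ∈ U} g(y) dy`. -/
theorem kerr_sliceEnergy_le_setLIntegral_closedBall (U : TopologicalSpace.Opens E4) (ψ : U → ℝ)
    (τ R : ℝ) (g : E3 → ℝ)
    (hzero : ∀ y : E3, E4.ofTimeSpace τ y ∈ U → R < ‖y‖ →
      coordEnergyDensity U ψ (E4.ofTimeSpace τ y) = 0)
    (hle : ∀ y : E3, E4.ofTimeSpace τ y ∈ U → ‖y‖ ≤ R →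
      coordEnergyDensity U ψ (E4.ofTimeSpace τ y) ≤ g y) :
    sliceEnergy U ψ τ ≤ ∫⁻ y in Metric.closedBall (0 : E3) R,
      {y : E3 | E4.ofTimeSpace τ y ∈ U}.indicator (fun y ↦ ENNReal.ofReal (g y)) y := by
  classical
  rw [sliceEnergy, ← lintegral_indicator measurableSet_closedBall]
  refine lintegral_mono fun y ↦ ?_
  by_cases hyU : E4.ofTimeSpace τ y ∈ U
  · by_cases hyR : ‖y‖ ≤ R
    · have hmem : y ∈ Metric.closedBall (0 : E3) R := by
        rw [Metric.mem_closedBall, dist_zero_right]; exact hyR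
      rw [Set.indicator_of_mem (show y ∈ {y : E3 | E4.ofTimeSpace τ y ∈ U} from hyU),
        Set.indicator_of_mem hmem,
        Set.indicator_of_mem (show y ∈ {y : E3 | E4.ofTimeSpace τ y ∈ U} from hyU)]
      exact ENNReal.ofReal_le_ofReal (hle y hyU hyR)
    · rw [Set.indicator_of_mem (show y ∈ {y : E3 | E4.ofTimeSpace τ y ∈ U} from hyU),
        hzero y hyU (not_le.mp hyR), ENNReal.ofReal_zero]
      exact bot_le
  · rw [Set.indicator_of_notMem (show y ∉ {y : E3 | E4.ofTimeSpace τ y ∈ U} from hyU)]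
    exact bot_le

/-- **Splitting a dominated energy integral**: for `e ≥ 0` and a constant `J ≥ 0`,
`∫_{‖y‖≤R} 𝟙_S (2 e + J) ≤ 2 ∫_{‖y‖≤R} 𝟙_S e + J · vol{‖y‖ ≤ R}`. -/
theorem kerr_setLIntegral_indicator_two_mul_add_le (S : Set E3) (e : E3 → ℝ) (he : ∀ y, 0 ≤ e y)
    {J : ℝ} (hJ : 0 ≤ J) (R : ℝ) :
    ∫⁻ y in Metric.closedBall (0 : E3) R, S.indicator (fun y ↦ ENNReal.ofReal (2 * e y + J)) y ≤
      2 * (∫⁻ y in Metric.closedBall (0 : E3) R, S.indicator (fun y ↦ ENNReal.ofReal (e y)) y) +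
        ENNReal.ofReal J * volume (Metric.closedBall (0 : E3) R) := by
  classical
  have hpt : ∀ y, S.indicator (fun y ↦ ENNReal.ofReal (2 * e y + J)) y ≤
      2 * S.indicator (fun y ↦ ENNReal.ofReal (e y)) y + ENNReal.ofReal J := by
    intro y
    by_cases hy : y ∈ S
    · rw [Set.indicator_of_mem hy, Set.indicator_of_mem hy,
        ENNReal.ofReal_add (by linarith [he y]) hJ, ENNReal.ofReal_mul (by norm_num),
        ENNReal.ofReal_ofNat]
    · rw [Set.indicator_of_notMem hy, Set.indicator_of_notMem hy]
      simp
  calc ∫⁻ y in Metric.closedBall (0 : E3) R, S.indicator (fun y ↦ ENNReal.ofReal (2 * e y + J)) y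
      ≤ ∫⁻ y in Metric.closedBall (0 : E3) R,
          (2 * S.indicator (fun y ↦ ENNReal.ofReal (e y)) y + ENNReal.ofReal J) :=
        lintegral_mono fun y ↦ hpt y
    _ = 2 * (∫⁻ y in Metric.closedBall (0 : E3) R, S.indicator (fun y ↦ ENNReal.ofReal (e y)) y) +
          ENNReal.ofReal J * volume (Metric.closedBall (0 : E3) R) := by
        rw [lintegral_add_right _ measurable_const, lintegral_const_mul' _ _ (by simp),
          setLIntegral_const]

/-- **Local positivity of the energy of a non-trivial Killing-mode pair.** Let `ψ, χ` be smooth on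
`Kerr.region a r₀` (`(M, a)` subextremal, `r₀ ≤ r₊`) with `∂_{t*}ψ = νψ − ωχ`, `∂_{t*}χ = ωψ + νχ`
on `{r > r₊}`, `ν > 0`, and let `p` be an exterior slice point (`p⁰ = 0`) where `(ψ, χ) ≠ (0, 0)`.
Then the summed coordinate energy density `e(y) = e_ψ(0, y) + e_χ(0, y)` is bounded below by a
positive constant `m` on a ball of exterior slice points around `p⃗`: at `p` it is at least
`(∂_{t*}ψ)² + (∂_{t*}χ)² = (ν² + ω²)(ψ² + χ²) > 0`, and it is continuous there. -/
theorem kerrModePair_local_energy_pos {M a r₀ ν w : ℝ} (hν : 0 < ν)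
    {ψ χ : Kerr.region a r₀ → ℝ}
    (hψ : ContMDiff 𝓘(ℝ, E4) 𝓘(ℝ, ℝ) ∞ ψ) (hχ : ContMDiff 𝓘(ℝ, E4) 𝓘(ℝ, ℝ) ∞ χ)
    (heig : ∀ x : Kerr.region a r₀, Kerr.rPlus M a < Kerr.radius a x.1 →
      mfderiv 𝓘(ℝ, E4) 𝓘(ℝ, ℝ) ψ x (Kerr.stationaryField a r₀ x) = ν * ψ x - w * χ x ∧
      mfderiv 𝓘(ℝ, E4) 𝓘(ℝ, ℝ) χ x (Kerr.stationaryField a r₀ x) = w * ψ x + ν * χ x)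
    (p : Kerr.region a r₀) (hp : Kerr.rPlus M a < Kerr.radius a p.1) (hp0 : (p : E4) 0 = 0)
    (hne : ¬(ψ p = 0 ∧ χ p = 0)) :
    ∃ (δ₀ m : ℝ), 0 < δ₀ ∧ 0 < m ∧ ∀ y ∈ Metric.ball (E4.spatial (p : E4)) δ₀,
      Kerr.rPlus M a < Kerr.radius a (E4.ofTimeSpace 0 y) ∧
        m ≤ coordEnergyDensity (Kerr.region a r₀) ψ (E4.ofTimeSpace 0 y) +
          coordEnergyDensity (Kerr.region a r₀) χ (E4.ofTimeSpace 0 y) := by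
  set Φ : E4 → ℝ := Function.extend Subtype.val ψ 0 with hΦ_def
  set X : E4 → ℝ := Function.extend Subtype.val χ 0 with hX_def
  set y₀ : E3 := E4.spatial (p : E4) with hy₀
  have hpeq : (p : E4) = E4.ofTimeSpace 0 y₀ := by
    conv_lhs => rw [← E4.ofTimeSpace_time_spatial (p : E4)]
    rw [E4.time_apply, hp0]
  set e : E3 → ℝ := fun y ↦ coordEnergyDensity (Kerr.region a r₀) ψ (E4.ofTimeSpace 0 y) +
    coordEnergyDensity (Kerr.region a r₀) χ (E4.ofTimeSpace 0 y) with he_def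
  -- positivity at `p`
  have hΦd : DifferentiableAt ℝ Φ p := (contDiffAt_extend hψ p).differentiableAt (by simp)
  have hXd : DifferentiableAt ℝ X p := (contDiffAt_extend hχ p).differentiableAt (by simp)
  obtain ⟨h1, h2⟩ := heig p hp
  rw [OpensChart.mfderiv_eq p ψ Φ (extend_rep ψ) hΦd] at h1
  rw [OpensChart.mfderiv_eq p χ X (extend_rep χ) hXd] at h2
  have h1' : fderiv ℝ Φ p (E4.basisVector 0) = ν * ψ p - w * χ p := h1
  have h2' : fderiv ℝ X p (E4.basisVector 0) = w * ψ p + ν * χ p := h2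
  have hsq : 0 < (ψ p) ^ 2 + (χ p) ^ 2 := by
    by_contra hle
    have h0 : (ψ p) ^ 2 + (χ p) ^ 2 = 0 := le_antisymm (not_lt.mp hle) (by positivity)
    have hψ0 : ψ p = 0 := by nlinarith [sq_nonneg (ψ p), sq_nonneg (χ p)]
    have hχ0 : χ p = 0 := by nlinarith [sq_nonneg (ψ p), sq_nonneg (χ p)]
    exact hne ⟨hψ0, hχ0⟩
  have hterm : ∀ (f : Kerr.region a r₀ → ℝ),
      (fderiv ℝ (Function.extend Subtype.val f 0) p (E4.basisVector 0)) ^ 2 ≤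
        coordEnergyDensity (Kerr.region a r₀) f (E4.ofTimeSpace 0 y₀) := by
    intro f
    rw [← hpeq]
    unfold coordEnergyDensity
    rw [Fin.sum_univ_succ]
    have hA : 0 ≤ ∑ i : Fin 3, (fderiv ℝ (Function.extend Subtype.val f 0) (p : E4)
        (EuclideanSpace.single (Fin.succ i) (1 : ℝ))) ^ 2 := Finset.sum_nonneg fun _ _ ↦ sq_nonneg _
    exact le_add_of_nonneg_right hA
  have hpos : 0 < e y₀ := by
    have hlow : (ν ^ 2 + w ^ 2) * ((ψ p) ^ 2 + (χ p) ^ 2) =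
        (fderiv ℝ Φ p (E4.basisVector 0)) ^ 2 + (fderiv ℝ X p (E4.basisVector 0)) ^ 2 := by
      rw [h1', h2']; ring
    have : 0 < (ν ^ 2 + w ^ 2) * ((ψ p) ^ 2 + (χ p) ^ 2) := mul_pos (by positivity) hsq
    have hψt := hterm ψ
    have hχt := hterm χ
    simp only [he_def]
    linarith
  -- continuity at `y₀`
  have hcont : ContinuousAt e y₀ := by
    have hc : ∀ (f : Kerr.region a r₀ → ℝ), ContMDiff 𝓘(ℝ, E4) 𝓘(ℝ, ℝ) ∞ f →
        ContinuousAt (fun y ↦ coordEnergyDensity (Kerr.region a r₀) f (E4.ofTimeSpace 0 y)) y₀ := by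
      intro f hf
      unfold coordEnergyDensity
      refine tendsto_finsetSum _ fun μ _ ↦ ?_
      have hF : ContDiffAt ℝ ∞ (Function.extend Subtype.val f 0) (E4.ofTimeSpace 0 y₀) := by
        rw [← hpeq]; exact contDiffAt_extend hf p
      have hd : ContinuousAt (fun z ↦ fderiv ℝ (Function.extend Subtype.val f 0) z
          (EuclideanSpace.single μ (1 : ℝ))) (E4.ofTimeSpace 0 y₀) :=
        (contDiffAt_fderiv_apply_const_infty hF _).continuousAt
      exact ((hd.comp (E4.continuous_ofTimeSpace 0).continuousAt).pow 2)
    exact (hc ψ hψ).add (hc χ hχ)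
  -- a ball around `y₀` of exterior slice points where `e ≥ e(y₀)/2`
  have hev1 : ∀ᶠ y in 𝓝 y₀, e y₀ / 2 < e y :=
    hcont.eventually (lt_mem_nhds (by linarith))
  have hev2 : ∀ᶠ y in 𝓝 y₀, Kerr.rPlus M a < Kerr.radius a (E4.ofTimeSpace 0 y) := by
    have hc : Continuous fun y ↦ Kerr.radius a (E4.ofTimeSpace 0 y) :=
      (Kerr.continuous_radius a).comp (E4.continuous_ofTimeSpace 0)
    refine hc.continuousAt.eventually (lt_mem_nhds ?_)
    show Kerr.rPlus M a < Kerr.radius a (E4.ofTimeSpace 0 y₀)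
    rw [← hpeq]; exact hp
  obtain ⟨δ₀, hδ₀, hball⟩ := Metric.eventually_nhds_iff_ball.mp (hev1.and hev2)
  exact ⟨δ₀, e y₀ / 2, hδ₀, by linarith, fun y hy ↦ ⟨(hball y hy).2, (hball y hy).1.le⟩⟩

end Summit.FinalStateConjecture.FinalStateConjecture.Theorems

end
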